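/-
Copyright (c) 2026. All rights reserved.
Released under Apache 2.0 license as described in the file LICENSE.
Authors: abc-iut cell, wave-2 seat abc-iut-L3-t11 (proof-only; G10 rungs 3b/4: edge-like subgroups lie
in verticial subgroups).
-/
import Literature.AnabelianGeometry.SemiGraphs.TemperedMaximalCompact
import HarnessLib

/-!
# [SemiAnbd] §3: every edge-like subgroup lies in a verticial subgroup of each abutting vertex

Mochizuki, *Semi-graphs of anabelioids*, Publ. RIMS **42** (2006) [MochizukiSemiAnbd2006], §3 pp. 36–41.
In abc-iut-L3-t2's local presentation (`TemperedCoverings.lean`) the objects of `B^cov(G)` carry gluing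
isomorphisms `S_e ≅ b^* S_v` along every branch `b` of `e` abutting to `v` (p. 36: the data `{S_v, φ_e}`),
and the verticial / edge-like subgroups of a tempered fundamental group `Π = c.G` are the images of the
continuous homomorphisms `Π_v → Π` / `Π_e → Π` whose pull-back functors are the restrictions `S ↦ S_v` /
`S ↦ S_e` (Thm 3.7 (i), (iii), pp. 40–41). This PROOF-ONLY file records the consequence used by
Thm 3.7 (iii)/(iv): for a branch `b` of `e` abutting to `v`,

* `nonempty_restrictE_iso_restrictV_res` — the gluings assemble to a natural isomorphism of functors
  `restrictE e ≅ restrictV v ⋙ B^temp(b_*)` on `B^cov(G)`;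
* `nonempty_res_comp_iso` — `B^temp(φ ∘ β) ≅ B^temp(φ) ⋙ B^temp(β)`;
* `exists_conj_le_of_mem_edgeLikeSubgroups` / `exists_mem_verticialSubgroups_ge` — **every edge-like
  subgroup of `e` is conjugate into, hence (verticial subgroups being a conjugacy class) contained in, a
  verticial subgroup at `v`**: by [SemiAnbd] Prop 3.2 (the tree's `BTemp.exists_conj_of_natTrans`) applied
  to `B^temp(ψ) ≅ (restriction to e) ≅ (restriction to v) ⋙ B^temp(b_*) ≅ B^temp(φ ∘ b_*)`.

No definitions; no statement of the paper is strengthened.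
-/

namespace Literature.AnabelianGeometry.SemiGraphs

open CategoryTheory Topology

universe u

/-! ### `B^temp` of a composite -/

namespace BTemp

variable {G₁ : Type u} [Group G₁] [TopologicalSpace G₁] {G₂ : Type u} [Group G₂] [TopologicalSpace G₂]
  {G₃ : Type u} [Group G₃] [TopologicalSpace G₃]

/-- `B^temp(φ ∘ β) ≅ B^temp(φ) ⋙ B^temp(β)` as functors `B^temp(Π₃) ⥤ B^temp(Π₁)` (both give the same
underlying set with `Π₁` acting through `φ ∘ β`). [cite: MochizukiSemiAnbd2006, Rmk 3.1.2 pp.33-34] -/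
theorem nonempty_res_comp_iso (β : G₁ →ₜ* G₂) (φ : G₂ →ₜ* G₃) :
    Nonempty (BTemp.res (φ.comp β) ≅ BTemp.res φ ⋙ BTemp.res β) := by
  refine ⟨NatIso.ofComponents (fun X =>
    { hom := homOfEquivariant ((BTemp.res (φ.comp β)).obj X) ((BTemp.res φ ⋙ BTemp.res β).obj X)
        id (fun _ _ => rfl)
      inv := homOfEquivariant ((BTemp.res φ ⋙ BTemp.res β).obj X) ((BTemp.res (φ.comp β)).obj X)
        id (fun _ _ => rfl)
      hom_inv_id := by
        apply ObjectProperty.hom_ext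
        apply Action.Hom.ext
        exact ConcreteCategory.hom_ext _ _ fun x => rfl
      inv_hom_id := by
        apply ObjectProperty.hom_ext
        apply Action.Hom.ext
        exact ConcreteCategory.hom_ext _ _ fun x => rfl }) (fun {X Y} f => ?_)⟩
  apply ObjectProperty.hom_ext
  apply Action.Hom.ext
  exact ConcreteCategory.hom_ext _ _ fun x => rfl

end BTemp

namespace ProfiniteSemiGraph

variable {𝒢 : ProfiniteSemiGraph.{u}}

/-! ### The gluings as a natural isomorphism of restriction functors -/

/-- **The gluing isomorphisms `S_e ≅ b^* S_v` are natural in `S`** (morphisms of `B^cov(G)` are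
"compatible with the gluings", `CovHom.comm`): `restrictE e ≅ restrictV v ⋙ B^temp(b_*)` for a branch `b`
of `e` abutting to `v`. [cite: MochizukiSemiAnbd2006, §3 p.36] -/
theorem nonempty_restrictE_iso_restrictV_res (b : 𝒢.graph.Branch) (v : 𝒢.graph.Vertex)
    (h : 𝒢.graph.abuts b = some v) :
    Nonempty (restrictE 𝒢 (𝒢.graph.edgeOf b) ≅ restrictV 𝒢 v ⋙ BTemp.res (𝒢.brHom b v h)) :=
  ⟨NatIso.ofComponents (fun S => S.glue b v h) (fun f => f.comm b v h)⟩

/-! ### Edge-like subgroups lie in verticial subgroups -/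

/-- For a branch `b` of `e` abutting to `v`, an edge-like homomorphism `ψ : Π_e → Π` and a verticial
homomorphism `φ : Π_v → Π` have `B^temp(ψ) ≅ B^temp(φ ∘ b_*)` (restriction to `e` = restriction to `v`
followed by `b^*`). [cite: MochizukiSemiAnbd2006, Thm 3.7(iii) p.41] -/
theorem nonempty_res_iso_res_comp_brHom (c : TemperedPiChart 𝒢) (b : 𝒢.graph.Branch)
    (v : 𝒢.graph.Vertex) (h : 𝒢.graph.abuts b = some v)
    (ψ : 𝒢.Ge (𝒢.graph.edgeOf b) →ₜ* c.G) (φ : 𝒢.Gv v →ₜ* c.G)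
    (iE : c.equiv.inverse ⋙ ObjectProperty.ι _ ⋙ restrictE 𝒢 (𝒢.graph.edgeOf b) ≅ BTemp.res ψ)
    (iV : c.equiv.inverse ⋙ ObjectProperty.ι _ ⋙ restrictV 𝒢 v ≅ BTemp.res φ) :
    Nonempty (BTemp.res ψ ≅ BTemp.res (φ.comp (𝒢.brHom b v h))) := by
  obtain ⟨glue⟩ := nonempty_restrictE_iso_restrictV_res b v h
  obtain ⟨comp⟩ := BTemp.nonempty_res_comp_iso (𝒢.brHom b v h) φ
  -- restriction to `e` ≅ (restriction to `v`) ⋙ `b^*`, under the chart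
  let i₁ : c.equiv.inverse ⋙ ObjectProperty.ι _ ⋙ restrictE 𝒢 (𝒢.graph.edgeOf b) ≅
      (c.equiv.inverse ⋙ ObjectProperty.ι _ ⋙ restrictV 𝒢 v) ⋙ BTemp.res (𝒢.brHom b v h) :=
    Functor.isoWhiskerLeft c.equiv.inverse (Functor.isoWhiskerLeft (ObjectProperty.ι _) glue) ≪≫
      Functor.isoWhiskerLeft c.equiv.inverse (Functor.associator _ _ _).symm ≪≫ (Functor.associator _ _ _).symm
  let i₂ : (c.equiv.inverse ⋙ ObjectProperty.ι _ ⋙ restrictV 𝒢 v) ⋙ BTemp.res (𝒢.brHom b v h) ≅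
      BTemp.res φ ⋙ BTemp.res (𝒢.brHom b v h) := Functor.isoWhiskerRight iV _
  exact ⟨iE.symm ≪≫ i₁ ≪≫ i₂ ≪≫ comp.symm⟩

/-- **Every edge-like subgroup is conjugate into every verticial subgroup of an abutting vertex**: for a
branch `b` of `e` at `v`, `L ∈ edgeLikeSubgroups c e`, `H ∈ verticialSubgroups c v`, there is `g ∈ Π` with
`g L g⁻¹ ≤ H` (Prop 3.2 applied to `B^temp(ψ) ≅ B^temp(φ ∘ b_*)`). [cite: MochizukiSemiAnbd2006, Thm 3.7(iii) p.41] -/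
theorem exists_conj_le_of_mem_edgeLikeSubgroups (c : TemperedPiChart 𝒢) {b : 𝒢.graph.Branch}
    {v : 𝒢.graph.Vertex} (h : 𝒢.graph.abuts b = some v) {L H : Subgroup c.G}
    (hL : L ∈ edgeLikeSubgroups c (𝒢.graph.edgeOf b)) (hH : H ∈ verticialSubgroups c v) :
    ∃ g : c.G, L.map (MulAut.conj g).toMonoidHom ≤ H := by
  obtain ⟨ψ, ⟨iE⟩, rfl⟩ := hL
  obtain ⟨φ, ⟨iV⟩, rfl⟩ := hH
  obtain ⟨i⟩ := nonempty_res_iso_res_comp_brHom c b v h ψ φ iE iV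
  obtain ⟨g, hg, -⟩ := BTemp.exists_conj_of_natTrans c.isTempered ψ (φ.comp (𝒢.brHom b v h)) i.hom
  refine ⟨g, ?_⟩
  rw [← range_eq_map_conj_of_conj_eq c ψ (φ.comp (𝒢.brHom b v h)) g hg]
  rintro x ⟨a, rfl⟩
  exact ⟨𝒢.brHom b v h a, rfl⟩

/-- **Every edge-like subgroup of `e` lies in some verticial subgroup at each abutting vertex `v`** (given
that `v` carries a verticial subgroup at all — Thm 3.7 (i)): conjugate back by `g⁻¹`, verticial subgroups
being stable under conjugation. [cite: MochizukiSemiAnbd2006, Thm 3.7(iii) p.41] -/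
theorem exists_mem_verticialSubgroups_ge (c : TemperedPiChart 𝒢) {b : 𝒢.graph.Branch}
    {v : 𝒢.graph.Vertex} (h : 𝒢.graph.abuts b = some v) {L : Subgroup c.G}
    (hL : L ∈ edgeLikeSubgroups c (𝒢.graph.edgeOf b)) (hv : (verticialSubgroups c v).Nonempty) :
    ∃ H ∈ verticialSubgroups c v, L ≤ H := by
  obtain ⟨H, hH⟩ := hv
  obtain ⟨g, hg⟩ := exists_conj_le_of_mem_edgeLikeSubgroups c h hL hH
  refine ⟨H.map (MulAut.conj g⁻¹).toMonoidHom, conj_mem_verticialSubgroups c hH g⁻¹, fun x hx => ?_⟩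
  refine ⟨g * x * g⁻¹, hg ⟨x, hx, rfl⟩, ?_⟩
  simp only [MulEquiv.coe_toMonoidHom, MulAut.conj_apply]
  group

/-- A compact subgroup lying in an edge-like subgroup of `e` lies in a verticial subgroup of every vertex
`e` abuts to. [cite: MochizukiSemiAnbd2006, Thm 3.7(iii) p.41] -/
theorem exists_mem_verticialSubgroups_ge_of_le_edgeLike (c : TemperedPiChart 𝒢) {b : 𝒢.graph.Branch}
    {v : 𝒢.graph.Vertex} (h : 𝒢.graph.abuts b = some v) {C L : Subgroup c.G}
    (hL : L ∈ edgeLikeSubgroups c (𝒢.graph.edgeOf b)) (hCL : C ≤ L)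
    (hv : (verticialSubgroups c v).Nonempty) : ∃ H ∈ verticialSubgroups c v, C ≤ H := by
  obtain ⟨H, hH, hLH⟩ := exists_mem_verticialSubgroups_ge c h hL hv
  exact ⟨H, hH, hCL.trans hLH⟩

end ProfiniteSemiGraph

end Literature.AnabelianGeometry.SemiGraphs
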